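import Summits.BirchSwinnertonDyer.BirchSwinnertonDyer.Theorems.Rank2ObservatoryRootNumberLocal
import Literature.NumberTheory.DiophantineGeometry.MinimalDiscriminantSpanProofs
import HarnessLib

/-!
# BSD rank ≥ 2 observatory (`b2b-bsdr2`): local root numbers of an integer model at the places of
# additive reduction of residue characteristic `p ≥ 5` (Rohrlich's formulae, read off `ord_p Δ`,
# `ord_p c₄`)

HONEST FRAMING: per-curve certified theorems and census instruments; no claim on BSD in rank ≥ 2.

For `W₀ : WeierstrassCurve ℤ` with `W₀ ⊗ ℚ` elliptic and a place `v` of `ℤ` over a prime `p ≥ 5`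
with `p ∣ c₄`, `pⁿ ∥ Δ`, `n ≥ 1`, and `n < 12` or `p⁴ ∤ c₄` (so the equation is minimal at `p` and
the reduction is additive), the tree's local root number `localRootNumberAt v (W₀ ⊗ ℚ)` (the prelude's transcription
of Rohrlich 1993, Prop. 2(iii)–(v)) is the explicit sign `rohrlichSign p n m`, `m = ord_p c₄`
(`none` when `c₄ = 0`):

* `3 m < n` (potentially multiplicative): `(−1 | p)`;
* else with `e = 12 / gcd (n, 12)`: `(−1 | p)` if `e ∈ {2, 6}`, `(−3 | p)` if `e = 3`,
  `(−2 | p)` otherwise (`e = 4`).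

Main results: `valuation_intCast_eq_exp` (`v (z) = exp (−k)` from `pᵏ ∥ z`), `addVal_intCast_eq`
(the additive valuation of `z` in `O_v` is `k`), `rohrlichSign`, and
`localRootNumberAt_eq_rohrlichSign`. Used by the kernel root-number certificates
(`Rank2ObservatoryRootNumberCert`) at the additive primes `p ≥ 5`.

References: Rohrlich 1993 [Rohrlich1993Compositio, Prop. 2]; Silverman AEC VII.1
[SilvermanAEC2009]; the prelude `Literature.NumberTheory.EllipticCurves.RootNumber`
(`WeierstrassCurve.localRootNumber`, case list).
-/

noncomputable section

open IsDedekindDomain Rat.HeightOneSpectrum WeierstrassCurve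

namespace Summit.BirchSwinnertonDyer.BirchSwinnertonDyer.Rank2Observatory.RootNumber

/-! ## Exact valuations of integers at a place of `ℤ` -/

section Valuation

variable (v : HeightOneSpectrum ℤ)

/-- `v (z) = exp (−k)` for an integer `z` with `pᵏ ∣ z`, `pᵏ⁺¹ ∤ z`. [folklore] -/
theorem valuation_intCast_eq_exp (z : ℤ) (k : ℕ) (h₁ : (natGenerator v : ℤ) ^ k ∣ z)
    (h₂ : ¬ (natGenerator v : ℤ) ^ (k + 1) ∣ z) :
    v.valuation ℚ (z : ℚ) = WithZero.exp (-(k : ℤ)) := by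
  have hle := (Literature.NumberTheory.EllipticCurves.Rat.valuation_intCast_le_exp_iff v z k).mpr h₁
  have hlt := (Literature.NumberTheory.EllipticCurves.Rat.exp_lt_valuation_intCast_iff v z
    (k + 1)).mpr h₂
  have hz : (z : ℚ) ≠ 0 := by
    rintro hz
    apply h₂
    rw [Int.cast_eq_zero] at hz
    simp [hz]
  have hne : v.valuation ℚ (z : ℚ) ≠ 0 := (Valuation.ne_zero_iff _).mpr hz
  obtain ⟨t, ht⟩ : ∃ t : ℤ, v.valuation ℚ (z : ℚ) = WithZero.exp t :=
    ⟨WithZero.log (v.valuation ℚ (z : ℚ)), (WithZero.exp_log hne).symm⟩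
  rw [ht] at hle hlt ⊢
  rw [WithZero.exp_le_exp] at hle
  rw [WithZero.exp_lt_exp] at hlt
  congr 1
  push_cast at hlt
  omega

/-- The additive valuation of an integer `z` with `pᵏ ∥ z` in the complete DVR `O_v` is `k`.
[folklore] -/
theorem addVal_intCast_eq (z : ℤ) (k : ℕ) (h₁ : (natGenerator v : ℤ) ^ k ∣ z)
    (h₂ : ¬ (natGenerator v : ℤ) ^ (k + 1) ∣ z) :
    IsDiscreteValuationRing.addVal (v.adicCompletionIntegers ℚ)
      (z : v.adicCompletionIntegers ℚ) = k := by
  apply WeierstrassCurve.addVal_adicCompletionIntegers_eq_of_valued_eq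
  have hc : ((z : v.adicCompletionIntegers ℚ) : v.adicCompletion ℚ) =
      algebraMap ℚ (v.adicCompletion ℚ) (z : ℚ) := by
    simp
  rw [hc, valued_algebraMap_adicCompletion, valuation_intCast_eq_exp v z k h₁ h₂]

end Valuation

/-! ## Rohrlich's sign at an additive prime `p ≥ 5` -/

/-- The branch condition "potentially multiplicative": `3 · ord_p c₄ < ord_p Δ` (`false` for
`c₄ = 0`, encoded `none`). [cite: Rohrlich1993Compositio, Prop. 2(iii)] -/
def potMult : Option ℕ → ℕ → Bool
  | none, _ => false
  | some m, n => decide (3 * m < n)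

/-- Rohrlich's local root number at an additive prime `p ≥ 5` as a function of `p`, `n = ord_p Δ`
and `m = ord_p c₄` (`none` for `c₄ = 0`) of a `p`-minimal equation: `(−1 | p)` if `3 m < n`
(potentially multiplicative) or `e ∈ {2, 6}`, `(−3 | p)` if `e = 3`, `(−2 | p)` otherwise, where
`e = 12 / gcd (n, 12)`; the symbols written out for odd `p` as residues mod `4`, `3`, `8`
(kernel-decidable). [cite: Rohrlich1993Compositio, Prop. 2(iii)-(v)] -/
def rohrlichSign (p n : ℕ) (m : Option ℕ) : ℤ :=
  if potMult m n then (if p % 4 = 1 then 1 else -1)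
  else if 12 / Nat.gcd n 12 = 2 ∨ 12 / Nat.gcd n 12 = 6 then (if p % 4 = 1 then 1 else -1)
  else if 12 / Nat.gcd n 12 = 3 then (if p % 3 = 1 then 1 else -1)
  else (if p % 8 = 1 ∨ p % 8 = 3 then 1 else -1)

section IntModel

variable {v : HeightOneSpectrum ℤ} {W₀ : WeierstrassCurve ℤ}

/-- `χ₄ (p) = (−1 | p)` written as a residue condition, `p` odd. [folklore] -/
theorem χ₄_eq_ite_of_odd {p : ℕ} (hp : p % 2 = 1) :
    ZMod.χ₄ p = if p % 4 = 1 then 1 else -1 := by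
  rw [ZMod.χ₄_nat_eq_if_mod_four]
  simp [hp]

/-- `χ₈' (p) = (−2 | p)` written as a residue condition, `p` odd. [folklore] -/
theorem χ₈'_eq_ite_of_odd {p : ℕ} (hp : p % 2 = 1) :
    ZMod.χ₈' p = if p % 8 = 1 ∨ p % 8 = 3 then 1 else -1 := by
  rw [ZMod.χ₈'_nat_eq_if_mod_eight]
  simp [hp]

/-- The additive valuation attached to `m = ord_p c₄`, `none ↦ ⊤` (`c₄ = 0`). [folklore] -/
def optENat : Option ℕ → ℕ∞
  | none => ⊤
  | some m => (m : ℕ∞)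

/-- The branch condition `3 · ord_p c₄ < ord_p Δ` in `ℕ∞` is `potMult`. [folklore] -/
theorem three_mul_optENat_lt_iff (m : Option ℕ) (n : ℕ) :
    3 * optENat m < (n : ℕ∞) ↔ potMult m n = true := by
  cases m with
  | none => simp [optENat, potMult]
  | some m =>
    simp only [optENat, potMult, decide_eq_true_eq]
    rw [show (3 : ℕ∞) * (m : ℕ∞) = ((3 * m : ℕ) : ℕ∞) by push_cast; rfl, Nat.cast_lt]

/-- **Local root number at an additive prime `p ≥ 5` from `ord_p Δ` and `ord_p c₄`.** For an
integer equation `W₀` with `W₀ ⊗ ℚ` elliptic and a place `v` over `p ≥ 5` with `p ∣ c₄`,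
`pⁿ ∥ Δ`, `n ≥ 1`, `n < 12` or `p⁴ ∤ c₄`, and `ord_p c₄ = m` (`m = none` encoding `c₄ = 0`), the
local root number of `W₀ ⊗ ℚ` at `v` is `rohrlichSign p n m`. Proof: the equation is minimal at `p`
(Silverman VII.1.1)
with additive reduction (`ord_p Δ, ord_p c₄ > 0`); the chosen minimal model differs from it by an
integral change of variables, which preserves the reduction type and the valuations of `Δ`, `c₄`
of the integral model; the residue field of `O_v` is `𝔽_p`; then the prelude's case list
(`WeierstrassCurve.localRootNumber`) is Rohrlich's formula.
[cite: Rohrlich1993Compositio, Prop. 2(iii)-(v)] -/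
theorem localRootNumberAt_eq_rohrlichSign [(W₀.baseChange ℚ).IsElliptic]
    (h5 : 5 ≤ natGenerator v) {n : ℕ} (hn₁ : 1 ≤ n)
    (hΔ : (natGenerator v : ℤ) ^ n ∣ W₀.Δ) (hΔ' : ¬ (natGenerator v : ℤ) ^ (n + 1) ∣ W₀.Δ)
    (hmin' : n < 12 ∨ ¬ (natGenerator v : ℤ) ^ 4 ∣ W₀.c₄)
    (hc₄ : (natGenerator v : ℤ) ∣ W₀.c₄) (m : Option ℕ) (hm₀ : m = none → W₀.c₄ = 0)
    (hm : ∀ k, m = some k →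
      (natGenerator v : ℤ) ^ k ∣ W₀.c₄ ∧ ¬ (natGenerator v : ℤ) ^ (k + 1) ∣ W₀.c₄) :
    (W₀.baseChange ℚ).localRootNumberAt v = rohrlichSign (natGenerator v) n m := by
  set O := v.adicCompletionIntegers ℚ with hO
  set Y := (W₀.baseChange ℚ).baseChange (v.adicCompletion ℚ) with hY
  have hp : (natGenerator v).Prime := prime_natGenerator v
  -- minimality at `p`: `ord_p Δ < 12` or `ord_p c₄ < 4`
  have hmin : (W₀.baseChange ℚ).IsMinimalAt v := by
    rcases hmin' with hn | h4
    · exact isMinimalAt_baseChange_int_of_not_pow_dvd_Δ fun h ↦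
        hΔ' (dvd_trans (pow_dvd_pow _ (by omega)) h)
    · exact isMinimalAt_of_lt_valuation_c₄ (isIntegralAt_baseChange_int v W₀)
        (by rw [baseChange_int_c₄]
            exact (Literature.NumberTheory.EllipticCurves.Rat.exp_lt_valuation_intCast_iff v _ 4).mpr h4)
  haveI : Y.IsMinimal O := hmin
  -- additive reduction at `v`
  have hadd : (W₀.baseChange ℚ).HasAdditiveReductionAt v := by
    rw [hasAdditiveReductionAt_iff_of_isMinimalAt hmin, baseChange_int_Δ, baseChange_int_c₄,
      Literature.NumberTheory.EllipticCurves.Rat.valuation_intCast_lt_one_iff,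
      Literature.NumberTheory.EllipticCurves.Rat.valuation_intCast_lt_one_iff]
    exact ⟨dvd_trans (dvd_pow_self _ (by omega)) hΔ, hc₄⟩
  -- the chosen minimal model
  have hD : Y.minimal O = (Y.exists_isMinimal O).choose • Y := rfl
  have hM : (Y.minimal O).HasAdditiveReduction O := hadd
  have hΔ0 : Y.Δ ≠ 0 := by
    rw [hY, baseChange, map_Δ]; exact ((W₀.baseChange ℚ).isUnit_Δ.map _).ne_zero
  have hg : ¬ (Y.minimal O).HasGoodReduction O := hM.not_hasGoodReduction O
  have hmu : ¬ (Y.minimal O).HasMultiplicativeReduction O := hM.not_hasMultiplicativeReduction O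
  have hs : ¬ (Y.minimal O).HasSplitMultiplicativeReduction O := fun h ↦
    hmu h.toHasMultiplicativeReduction
  -- residue field data
  have hℓ : ringChar (IsLocalRing.ResidueField O) = natGenerator v := ringChar_residueField v
  have hq : Nat.card (IsLocalRing.ResidueField O) = natGenerator v := natCard_residueField v
  -- valuations of the integral model
  have hI : Y.integralModel O = W₀.map (Int.castRingHom O) :=
    integralModel_baseChange_adicCompletion v W₀
  have hvΔ : IsDiscreteValuationRing.addVal O ((Y.minimal O).integralModel O).Δ = n := by
    rw [addVal_Δ_integralModel_eq_of_isMinimal_of_eq_smul O hD, hI, map_Δ, eq_intCast]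
    exact addVal_intCast_eq v _ n hΔ hΔ'
  have hvc₄ : IsDiscreteValuationRing.addVal O ((Y.minimal O).integralModel O).c₄ = optENat m := by
    rw [addVal_c₄_integralModel_eq_of_isMinimal_of_eq_smul O hD hΔ0, hI, map_c₄, eq_intCast]
    cases m with
    | none => rw [hm₀ rfl, Int.cast_zero, IsDiscreteValuationRing.addVal_zero]; rfl
    | some k => exact addVal_intCast_eq v _ k (hm k rfl).1 (hm k rfl).2
  have hodd : natGenerator v % 2 = 1 := hp.mod_two_eq_one_iff_ne_two.mpr (by omega)
  have hℓ' : ¬ (ringChar (IsLocalRing.ResidueField O) = 2 ∨ ringChar (IsLocalRing.ResidueField O) = 3) := by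
    rw [hℓ]; omega
  -- unfold the case list
  show Y.localRootNumber O = _
  simp only [WeierstrassCurve.localRootNumber, if_neg hg, if_neg hs, if_neg hmu, if_neg hℓ', hvΔ, hvc₄,
    hq, three_mul_optENat_lt_iff, ENat.toNat_coe, χ₄_eq_ite_of_odd hodd, χ₈'_eq_ite_of_odd hodd,
    rohrlichSign]

end IntModel

end Summit.BirchSwinnertonDyer.BirchSwinnertonDyer.Rank2Observatory.RootNumber

end
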